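import Summits.AtomisticToContinuum.Crystallization.Theorems.FrustratedLawDichotomyStrainedPatchHomValueT2SlopeSoundD

/-!
# (I1) slope part G — the per-label first-order force hull READ THROUGH THE GRAPH (`…HomValueT2Track` §14b, the junction-class entry `hp` uses the
# graph-combined box Jacobian `jF`; critic row 1674 (B) (I1) docket item 3 `slopeT2_sound`, seventh instalment; 27623 `(H) HomFloor`; decomp-a2c hand-1 g49)

With the track graph `δ_{6+m} = Σ_{e<6} A_me δ_e` (`A_me = aP m e/SC`), the derivative `Σ_{k<9} dF^ℝ_k δ_k` of a force component is
`Σ_{e<6} jF^ℝ_e δ_e` (`…SoundZ.lin_graph`), and `jF aP Rb a e ∋ jF^ℝ_e` along the whole segment (`mem_jF`); hence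
`|β y_a(1) − β y_a(0)| ≤ Σ_{e<6} |jF aP Rb a e|↑/SC · |δ_e|` (`force_label_hull_graph`, `B` family, `top = 9`), and its instantiation in the box
(`forceB_hull_graph`).  No definitions; 0 sorry; standard axioms.  `--supports stmt-AtomisticToContinuum-27623`.
-/

noncomputable section

namespace Summit.AtomisticToContinuum.Crystallization.Theorems.FrustratedLawDichotomyStrainedPatchHomValueT2Kit

open scoped BigOperators RealInnerProductSpace
open Finset
open Literature.Analysis.ValidatedNumerics.Numerics
open Summit.AtomisticToContinuum.Crystallization.Theorems.ChargedEnergyGapNegative (E3)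
open Summit.AtomisticToContinuum.Crystallization.Theorems.FrustratedLawDichotomySchurCut (effPot w₄₅ ω₄)
open Summit.AtomisticToContinuum.Crystallization.Theorems.FrustratedLawDichotomyStrainedPatchTaylorLeaves (junctions)
open Summit.AtomisticToContinuum.Crystallization.Theorems.FrustratedLawDichotomyStrainedPatchHomEntryGramHcp (dot3 mem_dot3 shufFI)
open Summit.AtomisticToContinuum.Crystallization.Theorems.FrustratedLawDichotomyStrainedPatchTaylorRegular (continuousOn_deriv_Wrec)
open Summit.AtomisticToContinuum.Crystallization.Theorems.FrustratedLawDichotomyStrainedPatchHomCurvCoeff3 (abs_le_of_mem)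
open Summit.AtomisticToContinuum.Crystallization.Theorems.FrustratedLawDichotomyStrainedPatchHomSplit (latPt hexFrame hcpShift)
open Summit.AtomisticToContinuum.Crystallization.Theorems.FrustratedLawDichotomyStrainedPatchHomCurvCentreKit (boxE cenMap cenShuf)

/-- ★★ **PER-LABEL FIRST-ORDER FORCE HULL THROUGH THE GRAPH** (`top = 9`). [folklore chaining: part D's proof with `lin_graph` + `mem_jF` in the bound] -/
theorem force_label_hull_graph (V ΔU : E3 →L[ℝ] E3) (q Δξ : E3) (hsym : ∀ a b : Fin 3, ent ΔU a b = ent ΔU b a) (aP : Fin 3 → Fin 6 → ℤ)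
    (A : ℕ → ℕ → ℝ) (hA : ∀ m e (hm : m < 3) (he : e < 6), A m e = ((aP ⟨m, hm⟩ ⟨e, he⟩ : ℤ) : ℝ) / SC)
    (hgraph : ∀ m, m < 3 → dispN ΔU Δξ (6 + m) = ∑ e ∈ range 6, A m e * dispN ΔU Δξ e)
    {EF : Fin 3 × Fin 3 → FI} {qF : Fin 3 → FI} {Rb : DRec} (hRb : mkDRec 9 EF qF = some Rb)
    (hEF : ∀ t ∈ Set.Icc (0 : ℝ) 1, ∀ ab : Fin 3 × Fin 3, FI.mem (((V + t • ΔU) (EuclideanSpace.single ab.2 (1 : ℝ))) ab.1) (EF ab))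
    (hqF : ∀ t ∈ Set.Icc (0 : ℝ) 1, ∀ c, FI.mem ((q + t • Δξ) c) (qF c)) (hJ0 : ‖V q‖ ∉ junctions) (a : Fin 3) :
    |deriv (effPot w₄₅ ω₄ (3 / 400)) ‖(V + ΔU) (q + Δξ)‖ / ‖(V + ΔU) (q + Δξ)‖ * ((V + ΔU) (q + Δξ)) a - deriv (effPot w₄₅ ω₄ (3 / 400)) ‖V q‖ / ‖V q‖ * (V q) a| ≤
      ∑ e ∈ range 6, (((jF aP Rb a e).absHi : ℤ) : ℝ) / SC * |dispN ΔU Δξ e| := by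
  have hS := SC_pos
  have hpos : ∀ t ∈ Set.Icc (0 : ℝ) 1, 0 < ‖(V + t • ΔU) (q + t • Δξ)‖ := fun t ht => norm_pos_of_mkDRec hRb _ _ (hEF t ht) (hqF t ht)
  have hcoF := mkDRec_coefL hRb
  have hQF : ∀ t ∈ Set.Icc (0 : ℝ) 1, FI.mem (‖(V + t • ΔU) (q + t • Δξ)‖ ^ 2) (dot3 (tab3 (yOf EF (tab3 qF))) (tab3 (yOf EF (tab3 qF)))) :=
    fun t ht => mem_labelQ _ _ (hEF t ht) (hqF t ht)
  have e0V : V + (0 : ℝ) • ΔU = V := by ext x; simp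
  have e0q : q + (0 : ℝ) • Δξ = q := by rw [zero_smul, add_zero]
  have e1V : V + (1 : ℝ) • ΔU = V + ΔU := by ext x; simp
  have e1q : q + (1 : ℝ) • Δξ = q + Δξ := by rw [one_smul]
  have hyc : Continuous fun t : ℝ => (V + t • ΔU) (q + t • Δξ) :=
    continuous_iff_continuousAt.2 fun t => (hasDerivAt_labelPath V ΔU q Δξ t).continuousAt
  have hgc : ContinuousOn (fun t : ℝ => deriv (effPot w₄₅ ω₄ (3 / 400)) ‖(V + t • ΔU) (q + t • Δξ)‖ / ‖(V + t • ΔU) (q + t • Δξ)‖ * ((V + t • ΔU) (q + t • Δξ)) a) (Set.Icc 0 1) := by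
    intro t ht
    have hρc : ContinuousAt (fun t : ℝ => ‖(V + t • ΔU) (q + t • Δξ)‖) t := (hyc.norm).continuousAt
    have hW' : ContinuousAt (fun t : ℝ => deriv (effPot w₄₅ ω₄ (3 / 400)) ‖(V + t • ΔU) (q + t • Δξ)‖) t :=
      ContinuousAt.comp (g := deriv (effPot w₄₅ ω₄ (3 / 400))) (continuousOn_deriv_Wrec.continuousAt (Ioi_mem_nhds (hpos t ht))) hρc
    exact ((hW'.div hρc (hpos t ht).ne').mul (hasDerivAt_apply_path V ΔU q Δξ a t).continuousAt).continuousWithinAt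
  classical
  set X : Finset ℝ := (finite_label_junctions V ΔU q Δξ hJ0).toFinset with hX
  have hXJ : ∀ t, t ∉ X → ‖(V + t • ΔU) (q + t • Δξ)‖ ∉ junctions := fun t ht hmem =>
    ht (by rw [hX, Set.Finite.mem_toFinset]; exact hmem)
  have hg : ∀ t ∈ Set.Ioo (0 : ℝ) 1, t ∉ X → HasDerivAt (fun t : ℝ => deriv (effPot w₄₅ ω₄ (3 / 400)) ‖(V + t • ΔU) (q + t • Δξ)‖ / ‖(V + t • ΔU) (q + t • Δξ)‖ * ((V + t • ΔU) (q + t • Δξ)) a)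
      (∑ k ∈ range 9, ((deriv (deriv (effPot w₄₅ ω₄ (3 / 400))) ‖(V + t • ΔU) (q + t • Δξ)‖ - deriv (effPot w₄₅ ω₄ (3 / 400)) ‖(V + t • ΔU) (q + t • Δξ)‖ / ‖(V + t • ΔU) (q + t • Δξ)‖) / ‖(V + t • ΔU) (q + t • Δξ)‖ ^ 2 * (zetaN (V + t • ΔU) (q + t • Δξ) k * ((V + t • ΔU) (q + t • Δξ)) a) + deriv (effPot w₄₅ ω₄ (3 / 400)) ‖(V + t • ΔU) (q + t • Δξ)‖ / ‖(V + t • ΔU) (q + t • Δξ)‖ * dyR (V + t • ΔU) (q + t • Δξ) k a) * dispN ΔU Δξ k) t :=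
    fun t ht htX => hasDerivAt_force_label V ΔU q Δξ hsym (hpos t (Set.Ioo_subset_Icc_self ht)) (hXJ t htX) a
  -- the bound, through the graph
  have hM : ∀ t ∈ Set.Ioo (0 : ℝ) 1, t ∉ X → |∑ k ∈ range 9, ((deriv (deriv (effPot w₄₅ ω₄ (3 / 400))) ‖(V + t • ΔU) (q + t • Δξ)‖ - deriv (effPot w₄₅ ω₄ (3 / 400)) ‖(V + t • ΔU) (q + t • Δξ)‖ / ‖(V + t • ΔU) (q + t • Δξ)‖) / ‖(V + t • ΔU) (q + t • Δξ)‖ ^ 2 * (zetaN (V + t • ΔU) (q + t • Δξ) k * ((V + t • ΔU) (q + t • Δξ)) a) + deriv (effPot w₄₅ ω₄ (3 / 400)) ‖(V + t • ΔU) (q + t • Δξ)‖ / ‖(V + t • ΔU) (q + t • Δξ)‖ * dyR (V + t • ΔU) (q + t • Δξ) k a) * dispN ΔU Δξ k| ≤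
      ∑ e ∈ range 6, (((jF aP Rb a e).absHi : ℤ) : ℝ) / SC * |dispN ΔU Δξ e| := by
    intro t ht htX
    have ht' := Set.Ioo_subset_Icc_self ht
    obtain ⟨mal, mbe⟩ := mem_coefL (hpos t ht') (hXJ t htX) (hQF t ht') hcoF
    have hF : ∀ k, k < 9 → FI.mem ((deriv (deriv (effPot w₄₅ ω₄ (3 / 400))) ‖(V + t • ΔU) (q + t • Δξ)‖ - deriv (effPot w₄₅ ω₄ (3 / 400)) ‖(V + t • ΔU) (q + t • Δξ)‖ / ‖(V + t • ΔU) (q + t • Δξ)‖) / ‖(V + t • ΔU) (q + t • Δξ)‖ ^ 2 * (zetaN (V + t • ΔU) (q + t • Δξ) k * ((V + t • ΔU) (q + t • Δξ)) a) + deriv (effPot w₄₅ ω₄ (3 / 400)) ‖(V + t • ΔU) (q + t • Δξ)‖ / ‖(V + t • ΔU) (q + t • Δξ)‖ * dyR (V + t • ΔU) (q + t • Δξ) k a) (dF Rb a k) :=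
      fun k hk => mem_dF le_rfl hRb (V + t • ΔU) (q + t • Δξ) (hEF t ht') (hqF t ht') mal mbe a hk
    rw [lin_graph (fun k => ((deriv (deriv (effPot w₄₅ ω₄ (3 / 400))) ‖(V + t • ΔU) (q + t • Δξ)‖ - deriv (effPot w₄₅ ω₄ (3 / 400)) ‖(V + t • ΔU) (q + t • Δξ)‖ / ‖(V + t • ΔU) (q + t • Δξ)‖) / ‖(V + t • ΔU) (q + t • Δξ)‖ ^ 2 * (zetaN (V + t • ΔU) (q + t • Δξ) k * ((V + t • ΔU) (q + t • Δξ)) a) + deriv (effPot w₄₅ ω₄ (3 / 400)) ‖(V + t • ΔU) (q + t • Δξ)‖ / ‖(V + t • ΔU) (q + t • Δξ)‖ * dyR (V + t • ΔU) (q + t • Δξ) k a)) (dispN ΔU Δξ) A hgraph]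
    refine (Finset.abs_sum_le_sum_abs _ _).trans (Finset.sum_le_sum fun e he' => ?_)
    have he : e < 6 := Finset.mem_range.1 he'
    rw [abs_mul]
    refine mul_le_mul_of_nonneg_right ?_ (abs_nonneg _)
    have hm := mem_jF aP Rb a (fun k => ((deriv (deriv (effPot w₄₅ ω₄ (3 / 400))) ‖(V + t • ΔU) (q + t • Δξ)‖ - deriv (effPot w₄₅ ω₄ (3 / 400)) ‖(V + t • ΔU) (q + t • Δξ)‖ / ‖(V + t • ΔU) (q + t • Δξ)‖) / ‖(V + t • ΔU) (q + t • Δξ)‖ ^ 2 * (zetaN (V + t • ΔU) (q + t • Δξ) k * ((V + t • ΔU) (q + t • Δξ)) a) + deriv (effPot w₄₅ ω₄ (3 / 400)) ‖(V + t • ΔU) (q + t • Δξ)‖ / ‖(V + t • ΔU) (q + t • Δξ)‖ * dyR (V + t • ΔU) (q + t • Δξ) k a)) hF he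
    rw [hA 0 e (by norm_num) he, hA 1 e (by norm_num) he, hA 2 e (by norm_num) he]
    refine abs_le_of_mem (I := jF aP Rb a e) ?_
    convert hm using 1
    ring
  have h := abs_sub_le_of_deriv_off X hgc hg hM
  rw [e0V, e0q, e1V, e1q] at h
  exact h

/-- ★★ **`B`-FAMILY FORCE HULL IN THE BOX, THROUGH THE GRAPH** (every label; the junction-class entry `hp` of `accSlope`): for `U` in the entry box and the
track point `ξ` with `δ_{6+m} = Σ_e A_me δ_e`. [folklore chaining] -/
theorem forceB_hull_graph {c w : (Fin 3 × Fin 3) ⊕ Fin 3 → ℤ} (U : E3 →L[ℝ] E3) (ξ : E3) (hsa : ∀ v v' : E3, ⟪U v, v'⟫ = ⟪v, U v'⟫)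
    (hc : ∀ a b : Fin 3, c (Sum.inl (a, b)) = c (Sum.inl (b, a)))
    (hbox : ∀ ab : Fin 3 × Fin 3, |(U (EuclideanSpace.single ab.2 (1 : ℝ))) ab.1 - (c (Sum.inl ab) : ℝ) / SC| ≤ (w (Sum.inl ab) : ℝ) / SC)
    (hξ : ∀ i : Fin 3, |ξ i - (c (Sum.inr i) : ℝ) / SC| ≤ (w (Sum.inr i) : ℝ) / SC) (aP : Fin 3 → Fin 6 → ℤ)
    (A : ℕ → ℕ → ℝ) (hA : ∀ m e (hm : m < 3) (he : e < 6), A m e = ((aP ⟨m, hm⟩ ⟨e, he⟩ : ℤ) : ℝ) / SC)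
    (hgraph : ∀ m, m < 3 → dispN (U - cenMap c) (ξ - cenShuf c) (6 + m) = ∑ e ∈ range 6, A m e * dispN (U - cenMap c) (ξ - cenShuf c) e)
    {b : Fin 3 → ℤ} {Rb : DRec} (hRb : mkDRec 9 (boxE c w) (qB (shufFI c w) b) = some Rb)
    (hJ : ‖latPt (cenMap c) hexFrame b + cenMap c (hcpShift + cenShuf c)‖ ∉ junctions) (a : Fin 3) :
    |deriv (effPot w₄₅ ω₄ (3 / 400)) ‖latPt U hexFrame b + U (hcpShift + ξ)‖ / ‖latPt U hexFrame b + U (hcpShift + ξ)‖ * (latPt U hexFrame b + U (hcpShift + ξ)) a - deriv (effPot w₄₅ ω₄ (3 / 400)) ‖cenMap c (latPt (1 : E3 →L[ℝ] E3) hexFrame b + (hcpShift + cenShuf c))‖ / ‖cenMap c (latPt (1 : E3 →L[ℝ] E3) hexFrame b + (hcpShift + cenShuf c))‖ * (cenMap c (latPt (1 : E3 →L[ℝ] E3) hexFrame b + (hcpShift + cenShuf c))) a| ≤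
      ∑ e ∈ range 6, (((jF aP Rb a e).absHi : ℤ) : ℝ) / SC * |dispN (U - cenMap c) (ξ - cenShuf c) e| := by
  have hsym := ent_symm_disp U hsa hc
  have hJ' : ‖cenMap c (latPt (1 : E3 →L[ℝ] E3) hexFrame b + (hcpShift + cenShuf c))‖ ∉ junctions := by
    rw [map_add, ← latPt_eq_apply_one]; exact hJ
  have eU : (cenMap c + (U - cenMap c)) ((latPt (1 : E3 →L[ℝ] E3) hexFrame b + (hcpShift + cenShuf c)) + (ξ - cenShuf c)) = latPt U hexFrame b + U (hcpShift + ξ) := by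
    have ea : (latPt (1 : E3 →L[ℝ] E3) hexFrame b + (hcpShift + cenShuf c)) + (ξ - cenShuf c) = latPt (1 : E3 →L[ℝ] E3) hexFrame b + (hcpShift + ξ) := by
      abel
    rw [add_sub_cancel, ea, map_add, ← latPt_eq_apply_one]
  have h := force_label_hull_graph (cenMap c) (U - cenMap c) (latPt (1 : E3 →L[ℝ] E3) hexFrame b + (hcpShift + cenShuf c)) (ξ - cenShuf c) hsym aP A hA hgraph hRb
    (fun t ht ab => mem_boxE_segment U hbox ht ab) (fun t ht cc => mem_qB_segment ξ hξ ht b cc) hJ' a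
  rw [eU] at h
  exact h

end Summit.AtomisticToContinuum.Crystallization.Theorems.FrustratedLawDichotomyStrainedPatchHomValueT2Kit
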